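import Summits.AtomisticToContinuum.HydrodynamicLimit.Theorems.TwoClocksEquilibriumShearWindowLDStatic
import Summits.AtomisticToContinuum.HydrodynamicLimit.Theorems.TwoClocksEquilibriumShearWindowLDWindows

/-!
# `EquilibriumShearWindowLD`: one good window gives all longer windows
# (route TwoClocks, stmt-AtomisticToContinuum-14446; `∃ τ` upgrades to `∃ τ₀ ∀ τ ≥ τ₀`)

Helper file (`--supports` stmt-AtomisticToContinuum-14446). The item asks, for each tilt `β` and
`ε > 0`, for ONE window parameter `τ` at which the window exponential moment of the kinetic shear
stress, `M_N(τ) = ∫ exp(β ∑ᵢ w⁻¹∫₀ʷ φ(xᵢ(r)) vᵢ⁰(r) vᵢ¹(r) dr) dG_N`, `w = τ(N+1)^{-1/3}`, is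
`≤ exp(ε(N+1))` eventually in `N`; the clamped collisional crux of the route
(`EquilibriumClampedCollisionalWindowLD`) is filed with the stronger `∃ τ₀ ∀ τ ≥ τ₀`. For the kinetic
functional the two forms are EQUIVALENT (`equilibriumShearWindowLD_iff_allWindows`), by the two
structural facts already landed for the item:

* log-subadditivity of `τ ↦ τ log M_N(τ)` (Hölder + invariance of the global Gibbs law,
  `lintegral_exp_window_add_le_geomMean`, `shearWindowMoment_nat_mul_le`), and
* the a priori bound `M_N(r) ≤ exp(c(β)(N+1))` for EVERY window `r` (`equilibriumShearWindowLD_apriori`).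

Writing `τ = kτ₁ + r` with `k ≥ m`, `0 ≤ r < τ₁`:
`M_N(τ) ≤ M_N(kτ₁)^{kτ₁/τ} M_N(r)^{r/τ} ≤ exp((N+1)(ε/2 + c⁺/m)) ≤ exp(ε(N+1))` once `m ≥ 2c⁺/ε`
(`shearWindowMoment_le_of_nat_mul_add`). So whoever proves the item at one window per `(β, ε)` has
proved it for all long windows, with the same threshold in `N`.

References: S. Olla, S. R. S. Varadhan, H.-T. Yau, Comm. Math. Phys. 155 (1993) 523, §2;
H. Spohn, *Large Scale Dynamics of Interacting Particles* (1991), Part I §2.3.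

prover-pitem-stmt-AtomisticToContinuum-14446-c2-0.
-/

noncomputable section

open MeasureTheory Real Set
open scoped ENNReal

namespace Summit.AtomisticToContinuum.HydrodynamicLimit.Theorems

open Literature.Analysis.FluidPDE Literature.MathematicalPhysics.KineticTheory
open Summit.AtomisticToContinuum.HydrodynamicLimit.Theses.TwoClocks

/-- `ofReal (exp A) ^ a = ofReal (exp (a A))`. [folklore] -/
theorem ofReal_exp_rpow (A a : ℝ) :
    ENNReal.ofReal (Real.exp A) ^ a = ENNReal.ofReal (Real.exp (a * A)) := by
  rw [ENNReal.ofReal_rpow_of_pos (Real.exp_pos _), ← Real.exp_mul, mul_comm]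

/-- **Subadditivity step for the item's window moment.** Under the global Gibbs law at rest, for a
continuous `φ`, a tilt `β`, a particle number `N`, windows `τ₁ > 0`, `r > 0` and `k ≥ 1`: if the
window exponential moment of the kinetic shear stress is `≤ exp A` at window parameter `τ₁` and
`≤ exp C` at window parameter `r`, then at `τ = kτ₁ + r` it is
`≤ exp((kτ₁/τ) A + (r/τ) C)` (`shearWindowMoment_nat_mul_le` for `M(kτ₁) ≤ M(τ₁)`, then Hölder +
invariance `lintegral_exp_window_add_le_geomMean` at the windows `kτ₁ s`, `r s`, `s = (N+1)^{-1/3}`).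
[folklore] -/
theorem shearWindowMoment_le_of_nat_mul_add (σ a₀ θ₀ : ℝ) (N : ℕ)
    (Φ : HardSphereFlow (Torus.geometry (Fin 3)) (hsDiameter σ N) (N + 1))
    {φ : T3 → ℝ} (hφ : Continuous φ) (β : ℝ) {τ₁ r : ℝ} (hτ₁ : 0 < τ₁) (hr : 0 < r)
    {k : ℕ} (hk : 1 ≤ k) {A C : ℝ}
    (hA : ∫⁻ z, ENNReal.ofReal (Real.exp (β * ∑ i : Fin (N + 1),
        (τ₁ * ((N : ℝ) + 1) ^ (-(1 / 3 : ℝ)))⁻¹ *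
          ∫ s in (0 : ℝ)..(τ₁ * ((N : ℝ) + 1) ^ (-(1 / 3 : ℝ))),
            φ (Φ.flow s z i).1 * ((Φ.flow s z i).2 0 * (Φ.flow s z i).2 1)))
        ∂(localGibbsLaw σ (fun _ => a₀) (fun _ => 0) (fun _ => θ₀) N Φ) ≤
      ENNReal.ofReal (Real.exp A))
    (hC : ∫⁻ z, ENNReal.ofReal (Real.exp (β * ∑ i : Fin (N + 1),
        (r * ((N : ℝ) + 1) ^ (-(1 / 3 : ℝ)))⁻¹ *
          ∫ s in (0 : ℝ)..(r * ((N : ℝ) + 1) ^ (-(1 / 3 : ℝ))),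
            φ (Φ.flow s z i).1 * ((Φ.flow s z i).2 0 * (Φ.flow s z i).2 1)))
        ∂(localGibbsLaw σ (fun _ => a₀) (fun _ => 0) (fun _ => θ₀) N Φ) ≤
      ENNReal.ofReal (Real.exp C)) :
    ∫⁻ z, ENNReal.ofReal (Real.exp (β * ∑ i : Fin (N + 1),
        (((k : ℝ) * τ₁ + r) * ((N : ℝ) + 1) ^ (-(1 / 3 : ℝ)))⁻¹ *
          ∫ s in (0 : ℝ)..(((k : ℝ) * τ₁ + r) * ((N : ℝ) + 1) ^ (-(1 / 3 : ℝ))),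
            φ (Φ.flow s z i).1 * ((Φ.flow s z i).2 0 * (Φ.flow s z i).2 1)))
        ∂(localGibbsLaw σ (fun _ => a₀) (fun _ => 0) (fun _ => θ₀) N Φ) ≤
      ENNReal.ofReal (Real.exp ((k : ℝ) * τ₁ / ((k : ℝ) * τ₁ + r) * A +
        r / ((k : ℝ) * τ₁ + r) * C)) := by
  set μ := localGibbsLaw σ (fun _ => a₀) (fun _ => 0) (fun _ => θ₀) N Φ with hμ
  set sN : ℝ := ((N : ℝ) + 1) ^ (-(1 / 3 : ℝ)) with hsN
  have hsN0 : 0 < sN := Real.rpow_pos_of_pos (by positivity) _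
  have hkpos : (0 : ℝ) < k := by exact_mod_cast hk
  have hw₁ : 0 < (k : ℝ) * τ₁ * sN := by positivity
  have hw₂ : 0 < r * sN := mul_pos hr hsN0
  have hF : Continuous fun y : T3 × V3 => φ y.1 * (y.2 0 * y.2 1) := by fun_prop
  -- `M(k τ₁) ≤ M(τ₁) ≤ exp A`
  have hk' : ∫⁻ z, ENNReal.ofReal (Real.exp (β * ∑ i : Fin (N + 1),
        ((k : ℝ) * τ₁ * sN)⁻¹ * ∫ s in (0 : ℝ)..((k : ℝ) * τ₁ * sN),
          φ (Φ.flow s z i).1 * ((Φ.flow s z i).2 0 * (Φ.flow s z i).2 1))) ∂μ ≤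
      ENNReal.ofReal (Real.exp A) :=
    (shearWindowMoment_nat_mul_le σ a₀ θ₀ N Φ φ hφ β hτ₁ k hk).trans hA
  -- Hölder + invariance at the windows `k τ₁ sN`, `r sN`
  have hH := lintegral_exp_window_add_le_geomMean Φ (localGibbsLaw_const_compl_good σ a₀ θ₀ 0 N Φ)
    hw₁ hw₂ (measurePreserving_flow_localGibbsLaw_const σ a₀ θ₀ 0 N Φ _) hF β
  have hsum : (k : ℝ) * τ₁ * sN + r * sN = ((k : ℝ) * τ₁ + r) * sN := by ring
  have ha : (k : ℝ) * τ₁ * sN / ((k : ℝ) * τ₁ * sN + r * sN) = (k : ℝ) * τ₁ / ((k : ℝ) * τ₁ + r) := by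
    rw [hsum, mul_div_mul_right _ _ hsN0.ne']
  have hb : r * sN / ((k : ℝ) * τ₁ * sN + r * sN) = r / ((k : ℝ) * τ₁ + r) := by
    rw [hsum, mul_div_mul_right _ _ hsN0.ne']
  rw [ha, hb, hsum] at hH
  have ha0 : 0 ≤ (k : ℝ) * τ₁ / ((k : ℝ) * τ₁ + r) := by positivity
  have hb0 : 0 ≤ r / ((k : ℝ) * τ₁ + r) := by positivity
  refine hH.trans ?_
  calc (∫⁻ z, ENNReal.ofReal (Real.exp (β * ∑ i : Fin (N + 1),
          ((k : ℝ) * τ₁ * sN)⁻¹ * ∫ s in (0 : ℝ)..((k : ℝ) * τ₁ * sN),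
            (fun y : T3 × V3 => φ y.1 * (y.2 0 * y.2 1)) (Φ.flow s z i))) ∂μ) ^
          ((k : ℝ) * τ₁ / ((k : ℝ) * τ₁ + r)) *
        (∫⁻ z, ENNReal.ofReal (Real.exp (β * ∑ i : Fin (N + 1),
          (r * sN)⁻¹ * ∫ s in (0 : ℝ)..(r * sN),
            (fun y : T3 × V3 => φ y.1 * (y.2 0 * y.2 1)) (Φ.flow s z i))) ∂μ) ^
          (r / ((k : ℝ) * τ₁ + r))
      ≤ ENNReal.ofReal (Real.exp A) ^ ((k : ℝ) * τ₁ / ((k : ℝ) * τ₁ + r)) *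
          ENNReal.ofReal (Real.exp C) ^ (r / ((k : ℝ) * τ₁ + r)) :=
        mul_le_mul' (ENNReal.rpow_le_rpow hk' ha0) (ENNReal.rpow_le_rpow hC hb0)
    _ = ENNReal.ofReal (Real.exp ((k : ℝ) * τ₁ / ((k : ℝ) * τ₁ + r) * A +
          r / ((k : ℝ) * τ₁ + r) * C)) := by
        rw [ofReal_exp_rpow, ofReal_exp_rpow, ← ENNReal.ofReal_mul (Real.exp_pos _).le,
          ← Real.exp_add]

/-- **`∃ τ` is as good as `∃ τ₀ ∀ τ ≥ τ₀` for `EquilibriumShearWindowLD`**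
(stmt-AtomisticToContinuum-14446): the item is equivalent to its version in which, for each tilt
`|β| ≤ β₀` and `ε > 0`, the bound `M_N(τ) ≤ exp(ε(N+1))` holds eventually in `N` for EVERY window
parameter `τ ≥ τ₀(β, ε)` (the quantifier shape of the route's clamped collisional crux).
`←` is specialisation. `→`: shrink `σ₀` below `1/2` and `β₀` below the a priori range of
`equilibriumShearWindowLD_apriori` (`M_N(r) ≤ exp(c(N+1))` for all `r > 0`, `N`); given `β`, `ε`,
take the item's window `τ₁` at `ε/2` and `τ₀ := m τ₁` with `m ≥ 2c⁺/ε`; for `τ ≥ τ₀` write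
`τ = kτ₁ + r`, `k = ⌊τ/τ₁⌋ ≥ m`, `0 ≤ r < τ₁`, and use `shearWindowMoment_nat_mul_le` (`r = 0`) or
`shearWindowMoment_le_of_nat_mul_add` (`r > 0`): the exponent is
`≤ (N+1)(ε/2 + (r/τ) c⁺) ≤ (N+1)(ε/2 + c⁺/m) ≤ ε(N+1)`. [folklore] -/
theorem equilibriumShearWindowLD_iff_allWindows :
    EquilibriumShearWindowLD ↔
      ∃ σ₀ : ℝ, 0 < σ₀ ∧ ∀ (a₀ θ₀ : ℝ), 0 < a₀ → 0 < θ₀ → ∀ σ : ℝ, 0 < σ → σ < σ₀ →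
        ∀ Φ : (N : ℕ) → HardSphereFlow (Torus.geometry (Fin 3)) (hsDiameter σ N) (N + 1),
        ∀ φ : T3 → ℝ, Continuous φ → ∃ β₀ : ℝ, 0 < β₀ ∧ ∀ β : ℝ, |β| ≤ β₀ → ∀ ε : ℝ, 0 < ε →
          ∃ τ₀ : ℝ, 0 < τ₀ ∧ ∀ τ : ℝ, τ₀ ≤ τ → ∃ N₀ : ℕ, ∀ N : ℕ, N₀ ≤ N →
            ∫⁻ z, ENNReal.ofReal (Real.exp (β * ∑ i : Fin (N + 1),
                (τ * ((N : ℝ) + 1) ^ (-(1 / 3 : ℝ)))⁻¹ *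
                  ∫ r in (0 : ℝ)..(τ * ((N : ℝ) + 1) ^ (-(1 / 3 : ℝ))),
                    φ ((Φ N).flow r z i).1 * (((Φ N).flow r z i).2 0 * ((Φ N).flow r z i).2 1)))
                ∂(localGibbsLaw σ (fun _ => a₀) (fun _ => 0) (fun _ => θ₀) N (Φ N)) ≤
              ENNReal.ofReal (Real.exp (ε * ((N : ℝ) + 1))) := by
  constructor
  · rintro ⟨σ₀, hσ₀, h⟩
    refine ⟨min σ₀ (1 / 2), lt_min hσ₀ (by norm_num), fun a₀ θ₀ ha hθ σ hσ hσσ Φ φ hφ => ?_⟩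
    have hσσ₀ : σ < σ₀ := hσσ.trans_le (min_le_left _ _)
    have hσ2 : σ ≤ 1 / 2 := (hσσ.trans_le (min_le_right _ _)).le
    obtain ⟨β₁, hβ₁, h₁⟩ := h a₀ θ₀ ha hθ σ hσ hσσ₀ Φ φ hφ
    obtain ⟨β₂, hβ₂, h₂⟩ := equilibriumShearWindowLD_apriori ha hθ hσ hσ2 Φ hφ
    refine ⟨min β₁ β₂, lt_min hβ₁ hβ₂, fun β hβ ε hε => ?_⟩
    obtain ⟨c, hc⟩ := h₂ β (hβ.trans (min_le_right _ _))
    obtain ⟨τ₁, hτ₁, N₀, hN₀⟩ := h₁ β (hβ.trans (min_le_left _ _)) (ε / 2) (half_pos hε)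
    -- `τ₀ := m τ₁` with `m ≥ 2 c⁺ / ε`, `m ≥ 1`
    set cp : ℝ := max c 0 with hcp
    have hcp0 : 0 ≤ cp := le_max_right _ _
    set m : ℕ := ⌈2 * cp / ε⌉₊ + 1 with hm
    have hm1 : (1 : ℝ) ≤ m := by
      rw [hm]; push_cast; linarith [Nat.cast_nonneg (α := ℝ) ⌈2 * cp / ε⌉₊]
    have hmpos : (0 : ℝ) < m := one_pos.trans_le hm1
    have hmc : 2 * cp / ε ≤ m := by
      rw [hm]; push_cast
      exact (Nat.le_ceil _).trans (le_add_of_nonneg_right zero_le_one)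
    have hcm : cp / m ≤ ε / 2 := by
      rw [div_le_iff₀ hmpos]
      rw [div_le_iff₀ hε] at hmc
      linarith
    refine ⟨(m : ℝ) * τ₁, by positivity, fun τ hτ => ⟨N₀, fun N hNN => ?_⟩⟩
    have hτpos : 0 < τ := (mul_pos hmpos hτ₁).trans_le hτ
    -- `τ = k τ₁ + r`, `k = ⌊τ/τ₁⌋ ≥ m ≥ 1`, `0 ≤ r < τ₁`
    set k : ℕ := ⌊τ / τ₁⌋₊ with hk
    have hq0 : 0 ≤ τ / τ₁ := (div_pos hτpos hτ₁).le
    have hkle : (k : ℝ) ≤ τ / τ₁ := Nat.floor_le hq0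
    have hklt : τ / τ₁ < (k : ℝ) + 1 := Nat.lt_floor_add_one _
    have hmk : m ≤ k := Nat.le_floor (by rwa [le_div_iff₀ hτ₁])
    have hk1 : 1 ≤ k := le_trans (by exact_mod_cast hm1 : 1 ≤ m) hmk
    have hkm : (m : ℝ) ≤ k := by exact_mod_cast hmk
    set r : ℝ := τ - (k : ℝ) * τ₁ with hr
    have hr0 : 0 ≤ r := by
      rw [hr, sub_nonneg]; rwa [le_div_iff₀ hτ₁] at hkle
    have hrτ₁ : r < τ₁ := by
      rw [hr, sub_lt_iff_lt_add]; rw [div_lt_iff₀ hτ₁] at hklt; linarith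
    have hτeq : τ = (k : ℝ) * τ₁ + r := by rw [hr]; ring
    have hA := hN₀ N hNN
    have hN1 : (0 : ℝ) < (N : ℝ) + 1 := by positivity
    rcases hr0.eq_or_lt with hr00 | hrpos
    · -- `r = 0`: `τ = k τ₁`
      have hτk : τ = (k : ℝ) * τ₁ := by rw [hτeq, ← hr00, add_zero]
      rw [hτk]
      refine (shearWindowMoment_nat_mul_le σ a₀ θ₀ N (Φ N) φ hφ β hτ₁ k hk1).trans (hA.trans ?_)
      exact ENNReal.ofReal_le_ofReal (Real.exp_le_exp.2 (by nlinarith))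
    · -- `r > 0`: subadditivity step with the a priori bound at window `r`
      have hCr := (hc r hrpos N).trans (ENNReal.ofReal_le_ofReal (Real.exp_le_exp.2
        (mul_le_mul_of_nonneg_right (le_max_left c 0) hN1.le)))
      rw [hτeq]
      refine (shearWindowMoment_le_of_nat_mul_add σ a₀ θ₀ N (Φ N) hφ β hτ₁ hrpos hk1 hA hCr).trans ?_
      refine ENNReal.ofReal_le_ofReal (Real.exp_le_exp.2 ?_)
      have hτ' : 0 < (k : ℝ) * τ₁ + r := by rw [← hτeq]; exact hτpos
      have ha1 : (k : ℝ) * τ₁ / ((k : ℝ) * τ₁ + r) ≤ 1 := by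
        rw [div_le_one hτ']; linarith
      have hbm : r / ((k : ℝ) * τ₁ + r) ≤ 1 / m := by
        rw [div_le_div_iff₀ hτ' hmpos, one_mul]
        nlinarith
      have h1 : (k : ℝ) * τ₁ / ((k : ℝ) * τ₁ + r) * (ε / 2 * ((N : ℝ) + 1)) ≤
          ε / 2 * ((N : ℝ) + 1) :=
        mul_le_of_le_one_left (by positivity) ha1
      have h2 : r / ((k : ℝ) * τ₁ + r) * (cp * ((N : ℝ) + 1)) ≤ ε / 2 * ((N : ℝ) + 1) := by
        calc r / ((k : ℝ) * τ₁ + r) * (cp * ((N : ℝ) + 1))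
            ≤ 1 / m * (cp * ((N : ℝ) + 1)) :=
              mul_le_mul_of_nonneg_right hbm (by positivity)
          _ = cp / m * ((N : ℝ) + 1) := by ring
          _ ≤ ε / 2 * ((N : ℝ) + 1) := mul_le_mul_of_nonneg_right hcm hN1.le
      linarith
  · rintro ⟨σ₀, hσ₀, h⟩
    refine ⟨σ₀, hσ₀, fun a₀ θ₀ ha hθ σ hσ hσσ Φ φ hφ => ?_⟩
    obtain ⟨β₀, hβ₀, hβ⟩ := h a₀ θ₀ ha hθ σ hσ hσσ Φ φ hφ
    refine ⟨β₀, hβ₀, fun β hb ε hε => ?_⟩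
    obtain ⟨τ₀, hτ₀, hτ⟩ := hβ β hb ε hε
    exact ⟨τ₀, hτ₀, hτ τ₀ le_rfl⟩

end Summit.AtomisticToContinuum.HydrodynamicLimit.Theorems

end
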